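import Summits.Langlands.Langlands.Theorems.IrreducibilityBySelfDualityPairLBoundaryJS
import Summits.Langlands.Langlands.Theorems.IrreducibilityBySelfDualityPairLBoundaryJSSsv
import Summits.Langlands.Langlands.Theorems.IrreducibilityBySelfDualityPairLBoundaryJSStandardEntire
import Summits.Langlands.Langlands.Theorems.IrreducibilityBySelfDualityPairLBoundaryJSIsOrthoOfLocalTranslate
import Summits.Langlands.Langlands.Theorems.IrreducibilityBySelfDualityPairLBoundaryJSEqConjOfLocalTranslate
import Summits.Langlands.Langlands.Theorems.IrreducibilityBySelfDualityPairLBoundaryJSLocalPairTranslate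
import Summits.Langlands.Langlands.Theorems.IrreducibilityBySelfDualityPairLBoundaryJSOfHumphriesJo
import Summits.Langlands.Langlands.Theorems.IrreducibilityBySelfDualityPairLBoundaryJSCornerBochnerIwasawa
import Summits.Langlands.Langlands.Theorems.IrreducibilityBySelfDualityPairLBoundaryJSCornerPairTranslate
import Summits.Langlands.Langlands.Theorems.IrreducibilityBySelfDualityPairLBoundaryJSCornerPairEuler
import Summits.Langlands.Langlands.Theorems.IrreducibilityBySelfDualityPairLBoundaryJSCornerAbsMajorant
import Summits.Langlands.Langlands.Theorems.IrreducibilityBySelfDualityPairLBoundaryJSCornerAbsIdeleMoment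
import Literature.NumberTheory.Automorphic.PairLFunctionMeromorphicContinuationRankNeTwistProofs
import Literature.NumberTheory.Automorphic.ArchRankinSelbergTestVector
import Literature.NumberTheory.Automorphic.JPSSGlobalIntegralQuotientUnfolding
import Literature.NumberTheory.Automorphic.JPSSCornerWhittakerUnfolding
import Literature.NumberTheory.Automorphic.WhittakerPeriodExchange
import Literature.NumberTheory.Automorphic.TorusIwasawaTransport
import Literature.NumberTheory.Automorphic.CornerTorusIwasawaData
import Literature.NumberTheory.Automorphic.WhittakerCoeffHonestCuspForm
import Literature.NumberTheory.Automorphic.WhittakerCoeffTranslateUnramified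
import Literature.NumberTheory.Automorphic.WhittakerDecayCuspForm
import Literature.NumberTheory.Automorphic.WhittakerSupportFinite
import Literature.NumberTheory.Automorphic.RankinSelbergUnramifiedTorus
import Literature.NumberTheory.Automorphic.RankinSelbergTorusPairEuler
import Literature.NumberTheory.Automorphic.RankinSelbergTowerFiniteness
import Literature.NumberTheory.Automorphic.ShintaniWhittakerTranslate

/-!
# The translated Whittaker coefficient of an honest cusp form is an unramified torus datum

Summit `Langlands`, sub-problem `Langlands`, helper file under `Theorems/` supporting the crux
`PairLBoundaryJS` (stmt-Langlands-13622), line `Sketch`, registered stub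
`stub_honest_translate_unramified` (W-Tr). The Euler factorisation of the unfolded `GL_{m+1} × GL_m`
corner integral (Cogdell (2004), Thm. 2.2 / Thm. 3.3) needs, at every good place `v`, that the global
Whittaker coefficient of the HONEST cusp form `φ = invQuot Φ` is an unramified Whittaker–Hecke torus datum
(`IsTorusUnramifiedAt`). Tate's character `ψ` has conductor `𝔡_v⁻¹` at `v ∣ 𝔡_K`, so one LEFT-translates
by `T ∈ GL_n(𝔸_K)` with `T_v = diag(d)`, `d_i / d_{i+1} = a`, `ψ_v(a ·)` of conductor `𝒪_v`
("translating the essential vector", Cogdell (2004), §3.1). The tree proves this for SMOOTHED `L²`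
vectors (`exists_isTorusUnramifiedAt_whittakerCoeff_smoothedForm_translate`) and, WITHOUT translation, for
honest continuous representatives `Φ` of a `K(𝔫₀)`-fixed vector `sv ∈ Π`
(`exists_isTorusUnramifiedAt_whittakerCoeff_of_ae_eq`). Here the two are merged:

* `exists_isTorusUnramifiedAt_whittakerCoeff_of_ae_eq_translate` — for `Π` cuspidal with Satake family
  `α` off `S`, `sv ∈ Π` represented by the continuous `Φ` with `invQuot Φ` right `K(𝔫₀)`-invariant,
  `v ∉ S`, `v ∤ 𝔫₀`, `T_v = diag(d)` with constant ratios `a` and `ψ_v(a ·)` of conductor `𝒪_v`, the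
  translate `g ↦ W_φ(T g)` is an unramified torus datum at `v` with parameters `x` (an enumeration of
  `α v`): write `T = ι_v(d) T'` with `T'_v = 1`, commute `T'` past `ι_v(GL_n(K_v))`
  (`GLn.ofLocal_mul_eq_mul_ofLocal_of_toLocal_eq_one`) and apply the translated Shintani formula
  `apply_diagonalGL_mul_piPowGL_eq_schur_mul` to the local datum
  `isUnramifiedWhittakerDatum_whittakerCoeff_ofLocal` fed with the pointwise Hecke equations
  `sum_invQuot_mul_ofLocal_rep_eq_of_ae_eq` of the continuous representative;
* `stub_honest_translate_unramified` — the registered `∀`-closed form.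

## References

* T. Shintani, *On an explicit formula for class-1 Whittaker functions on `GL_n` over `P`-adic
  fields*, Proc. Japan Acad. 52 (1976), Theorem (p. 181) [Shintani1976].
* J. W. Cogdell, *Analytic theory of L-functions for GL_n*, in *An Introduction to the Langlands
  Program* (2004), §3.1, Thm. 3.3 [CogdellAnalyticTheory2004].
-/

noncomputable section

-- `Summit.Langlands.Langlands.…` (summit = sub-problem name, D-0017 layout) trips `dupNamespace`
set_option linter.dupNamespace false

open scoped MatrixGroups Topology Pointwise ENNReal NNReal ComplexConjugate InnerProductSpace ContDiff
-- the place subtypes indexing `mixedSpace K` are `Fintype` classically (`NormedCommRing (mixedSpace K)`)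
open scoped Classical Matrix.Norms.Operator
open NumberField IsDedekindDomain MeasureTheory Measure Matrix Set Filter WithZero
open NumberField.mixedEmbedding
open Literature.NumberTheory.Automorphic AdelicGroupData
open Literature.NumberTheory.GaloisRepresentations (ideleGroup HeckeCharacter)
open Literature.MeasureTheory.Group
open Literature.RingTheory.SymmetricFunctions.SymmPoly
open ValuativeRel

-- the automorphic quotient carries the tree's Borel σ-algebra, not Mathlib's quotient σ-algebra
attribute [-instance] Quotient.instMeasurableSpace QuotientGroup.measurableSpace

-- the house local instances, exactly as in `RankinSelbergUnfoldingIdentity`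
attribute [local instance] adelicBorel borelSpace_adelic locallyCompactSpace_adelic secondCountableTopology_gl_adelic
  glAdeleBorel borelSpace_glAdele borelSpace_ideleGroup secondCountableTopology_ideleGroup

-- Mathlib idiom: the commutator Lie ring on matrices, to mention `(archGroupGL n K).lie`
attribute [local instance 100] LieRing.ofAssociativeRing

namespace Summit.Langlands.Langlands.Theorems.HonestTranslateUnramified

section Cuspidal

variable {n : ℕ} {K : Type} [Field K] [NumberField K]
  {μ : Measure (AdelicGroupData.gl n K).automorphicQuotient}
  [(AdelicGroupData.gl n K).IsAutomorphicMeasure μ]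
variable [MeasurableSpace ↥(adelicUnipotent n K)] [BorelSpace ↥(adelicUnipotent n K)]
  [MeasurableConstSMul ↥(rationalUnipotent n K) ↥(adelicUnipotent n K)]
  {ν : Measure ↥(adelicUnipotent n K)} [IsFiniteMeasureOnCompacts ν]
  [SMulInvariantMeasure ↥(rationalUnipotent n K) ↥(adelicUnipotent n K) ν] [ν.IsMulRightInvariant]
  {𝓕 : Set ↥(adelicUnipotent n K)} {ψ : AddChar (AdeleRing (𝓞 K) K) Circle}

/-- **The translated global Whittaker coefficient of a continuous representative of a `K(𝔫₀)`-fixed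
cuspidal vector is an unramified torus datum, for `ψ_v` of any conductor.** Let `Π` be cuspidal with
Satake family `α` off `S`, `sv ∈ Π` (`𝔫₀ ≠ 0`) represented by the continuous `Φ` with `φ = invQuot Φ`
right `K(𝔫₀)`-invariant, `ψ` a global additive character, `𝓕` a relatively compact fundamental domain of
`N_n(K)` in `N_n(𝔸_K)`, `v ∉ S`, `v ∤ 𝔫₀`, `x` an enumeration of `α v`; let `T ∈ GL_n(𝔸_K)` have
`v`-component `diag(d_i)` with constant ratios `d_i d_{i+1}⁻¹ = a`, where `ψ_v(a ·)` has conductor `𝒪_v`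
(trivial on `𝒪_v`, non-trivial on `ϖ⁻¹ 𝒪_v` for every normalised uniformizer). Then for the uniformizer
`ϖ` of the Satake datum, `g ↦ W_φ(T g)` is an unramified torus datum at `v` with parameters `x`:
sphericity from the level (`apply_mul_ofLocal_of_rightInvariant`), and
`W_φ(T ι_v(ϖ^μ) g) = q_v^{-b(μ)/2} s_μ(x) W_φ(T g)` for `g_v = 1` (with the vanishing off the antitone
cone) by `T = ι_v(d) T'`, `T'_v = 1`, and the translated Shintani formula
`apply_diagonalGL_mul_piPowGL_eq_schur_mul` for the local datum `y ↦ W_φ(ι_v(y) T' g)` fed with the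
pointwise Hecke equations `sum_invQuot_mul_ofLocal_rep_eq_of_ae_eq`. [cite: Shintani1976, Theorem (p. 181)]
[cite: CogdellAnalyticTheory2004, §3.1, Thm. 3.3] -/
theorem exists_isTorusUnramifiedAt_whittakerCoeff_of_ae_eq_translate
    (P : CuspidalAutomorphicRepGL n K μ)
    {S : Set (HeightOneSpectrum (𝓞 K))} {α : SatakeFamily K} (hα : IsSatakeFamilyOf P S α)
    {𝔫₀ : Ideal (𝓞 K)} (h𝔫₀ : 𝔫₀ ≠ 0) {v : HeightOneSpectrum (𝓞 K)} (hvS : v ∉ S)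
    (hv : ¬ v.asIdeal ∣ 𝔫₀) {Φ : (AdelicGroupData.gl n K).automorphicQuotient → ℂ} (hΦc : Continuous Φ)
    (sv : P.1.toSubmodule)
    (hae : ((sv : (AdelicGroupData.gl n K).L2 μ) : (AdelicGroupData.gl n K).automorphicQuotient → ℂ) =ᵐ[μ] Φ)
    (hΦU : ∀ k ∈ principalCongruenceLevel n K 𝔫₀, ∀ y : GL (Fin n) (AdeleRing (𝓞 K) K),
      invQuot (AdelicGroupData.gl n K) Φ (y * k) = invQuot (AdelicGroupData.gl n K) Φ y)
    {x : Fin n → ℂ} (hx : (Finset.univ : Finset (Fin n)).val.map x = α v)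
    (h𝓕 : IsFundamentalDomain ↥(rationalUnipotent n K) 𝓕 ν) (h𝓕c : IsCompact (closure 𝓕))
    (hψ : IsGlobalAddChar K ψ) {T : GL (Fin n) (AdeleRing (𝓞 K) K)}
    {d : Fin n → (v.adicCompletion K)ˣ} {a : (v.adicCompletion K)ˣ}
    (hT : localComponent v T = diagonalGL (Fin n) (v.adicCompletion K) d)
    (hd : ∀ i j : Fin n, (i : ℕ) + 1 = j →
      (d i : v.adicCompletion K) * ((d j)⁻¹ : (v.adicCompletion K)ˣ) = a)
    (hψa : ∀ c ∈ 𝒪[v.adicCompletion K], ψ.adicComponent v (a * c) = 1)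
    (hψa' : ∀ ϖ : v.adicCompletion K, Valued.v ϖ = WithZero.exp (-1 : ℤ) →
      ∃ c ∈ 𝒪[v.adicCompletion K], ψ.adicComponent v (a * (ϖ⁻¹ * c)) ≠ 1) :
    ∃ ϖ : (v.adicCompletion K)ˣ, IsTorusUnramifiedAt n K
      (fun g => whittakerCoeff ν 𝓕 ψ (invQuot (AdelicGroupData.gl n K) Φ) (T * g)) v ϖ x := by
  -- the pointwise Hecke equations of the continuous representative at `v`
  have hsvK : sv ∈ P.1.fixedVectors (principalCongruenceLevel n K 𝔫₀) :=
    mem_fixedVectors_of_ae_eq P.1 sv hae hΦU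
  obtain ⟨ϖ, hϖ, hHecke⟩ := sum_invQuot_mul_ofLocal_rep_eq_of_ae_eq P hα h𝔫₀ hvS hv hΦc sv hae hsvK hx
  set φ : GL (Fin n) (AdeleRing (𝓞 K) K) → ℂ := invQuot (AdelicGroupData.gl n K) Φ with hφ
  -- sphericity from the level and integrability of the Whittaker integrand
  have hφK : ∀ k ∈ glInt n (v.adicCompletion K), ∀ y : GL (Fin n) (AdeleRing (𝓞 K) K),
      φ (y * GLn.ofLocal n K v k) = φ y :=
    fun k hk y => apply_mul_ofLocal_of_rightInvariant h𝔫₀ hv hΦU hk y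
  have hφc : Continuous φ := continuous_invQuot_of_continuous hΦc
  have hint : ∀ g, IntegrableOn (fun u : ↥(adelicUnipotent n K) =>
      φ ((u : GL (Fin n) (AdeleRing (𝓞 K) K)) * g) * conj (whittakerCharFun ψ u)) 𝓕 ν := fun g =>
    integrableOn_whittakerIntegrand_of_continuous h𝓕c hψ.continuous hφc g
  have hs : (((Real.sqrt (v.residueCard : ℝ) : ℝ) : ℂ)) ≠ 0 := by
    rw [Complex.ofReal_ne_zero, Real.sqrt_ne_zero']
    exact_mod_cast zero_lt_one.trans v.one_lt_residueCard
  have hq' : ((Nat.card 𝓀[v.adicCompletion K] : ℕ) : ℂ) =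
      (((Real.sqrt (v.residueCard : ℝ) : ℝ) : ℂ)) ^ 2 := by
    rw [natCard_valuativeResidueField_adicCompletion_eq, ← Complex.ofReal_pow,
      Real.sq_sqrt (Nat.cast_nonneg _), Complex.ofReal_natCast]
  obtain ⟨c, hc, hcne⟩ := hψa' ϖ hϖ
  -- `T = ι_v(d) T'` with `T'_v = 1`
  set T' : GL (Fin n) (AdeleRing (𝓞 K) K) := T * GLn.ofLocal n K v (localComponent v T)⁻¹ with hT'
  have hT'1 : Matrix.GeneralLinearGroup.map (AdelicGroupData.adeleEval K v) T' = 1 :=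
    localComponent_mul_ofLocal_inv T
  have hTT' : T = GLn.ofLocal n K v (diagonalGL (Fin n) (v.adicCompletion K) d) * T' := by
    rw [hT', ← hT, GLn.ofLocal_mul_eq_mul_ofLocal_of_toLocal_eq_one _ hT'1, mul_assoc, ← map_mul,
      inv_mul_cancel, map_one, mul_one]
  clear_value T'
  -- `T'` commutes with `ι_v(GL_n(K_v))`
  have key : ∀ (y : GL (Fin n) (v.adicCompletion K)) (X : GL (Fin n) (AdeleRing (𝓞 K) K)),
      T * (GLn.ofLocal n K v y * X) =
        GLn.ofLocal n K v (diagonalGL (Fin n) (v.adicCompletion K) d * y) * (T' * X) := fun y X => by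
    rw [hTT', map_mul]
    simp only [mul_assoc]
    congr 1
    rw [← mul_assoc, ← GLn.ofLocal_mul_eq_mul_ofLocal_of_toLocal_eq_one y hT'1, mul_assoc]
  refine ⟨ϖ, hϖ, fun k hk g => ?_, fun g hg mu => ?_⟩
  · -- sphericity
    show whittakerCoeff ν 𝓕 ψ φ (T * (g * GLn.ofLocal n K v k)) = whittakerCoeff ν 𝓕 ψ φ (T * g)
    rw [← mul_assoc]
    exact whittakerCoeff_mul_of_forall ν 𝓕 ψ (hφK k hk) _
  · -- Shintani along `d ϖ^μ` for the local datum `y ↦ W(ι_v(y) T' g)`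
    have hg' : Matrix.GeneralLinearGroup.map (AdelicGroupData.adeleEval K v) (T' * g) = 1 := by
      rw [map_mul, hT'1, hg, one_mul]
    have hD := isUnramifiedWhittakerDatum_whittakerCoeff_ofLocal h𝓕 hψ (isLeftInvariant_invQuot _ _) hφK
      (isUniformizingElement_of_valued_eq K v hϖ) hHecke hint hg'
    have h1 : T * (GLn.ofLocal n K v (piPowGL (isUniformizingElement_of_valued_eq K v hϖ).ne_zero mu) * g) =
        GLn.ofLocal n K v (diagonalGL (Fin n) (v.adicCompletion K) d *
          piPowGL (isUniformizingElement_of_valued_eq K v hϖ).ne_zero mu) * (T' * g) := key _ g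
    have h2 : T * g = GLn.ofLocal n K v (diagonalGL (Fin n) (v.adicCompletion K) d) * (T' * g) := by
      rw [hTT', mul_assoc]
    show whittakerCoeff ν 𝓕 ψ φ (T * (GLn.ofLocal n K v _ * g)) = _ * whittakerCoeff ν 𝓕 ψ φ (T * g)
    rw [h1, h2]
    by_cases hmu : Antitone mu
    · rw [schurTrunc, if_pos hmu]
      exact apply_diagonalGL_mul_piPowGL_eq_schur_mul hD d a hd hψa ⟨c, hc, hcne⟩ hs hq' hmu
    · rw [schurTrunc, if_neg hmu, mul_zero, zero_mul]
      exact apply_diagonalGL_mul_piPowGL_eq_zero_of_not_antitone hD d a hd ⟨c, hc, hcne⟩ hmu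

end Cuspidal

/-- **STUB W-Tr (registered form)** — the translated Whittaker coefficient of an honest cusp form is an
unramified torus datum at a good place of any conductor: the `∀`-closed statement of
`exists_isTorusUnramifiedAt_whittakerCoeff_of_ae_eq_translate`. [cite: CogdellAnalyticTheory2004, §3.1, Thm. 3.3] -/
theorem stub_honest_translate_unramified :
    ∀ {n : ℕ} {K : Type} [Field K] [NumberField K]
      {μ : Measure (AdelicGroupData.gl n K).automorphicQuotient} [(AdelicGroupData.gl n K).IsAutomorphicMeasure μ]
      [MeasurableSpace ↥(adelicUnipotent n K)] [BorelSpace ↥(adelicUnipotent n K)]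
      [MeasurableConstSMul ↥(rationalUnipotent n K) ↥(adelicUnipotent n K)]
      {ν : Measure ↥(adelicUnipotent n K)} [IsFiniteMeasureOnCompacts ν]
      [SMulInvariantMeasure ↥(rationalUnipotent n K) ↥(adelicUnipotent n K) ν] [ν.IsMulRightInvariant]
      {𝓕 : Set ↥(adelicUnipotent n K)} {ψ : AddChar (AdeleRing (𝓞 K) K) Circle}
      (P : CuspidalAutomorphicRepGL n K μ)
      {S : Set (HeightOneSpectrum (𝓞 K))} {α : SatakeFamily K}, IsSatakeFamilyOf P S α →
      ∀ {𝔫₀ : Ideal (𝓞 K)}, 𝔫₀ ≠ 0 → ∀ {v : HeightOneSpectrum (𝓞 K)}, v ∉ S → ¬ v.asIdeal ∣ 𝔫₀ →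
      ∀ {Φ : (AdelicGroupData.gl n K).automorphicQuotient → ℂ}, Continuous Φ →
      ∀ (sv : P.1.toSubmodule),
      (((sv : (AdelicGroupData.gl n K).L2 μ) : (AdelicGroupData.gl n K).automorphicQuotient → ℂ) =ᵐ[μ] Φ) →
      (∀ k ∈ principalCongruenceLevel n K 𝔫₀, ∀ y : GL (Fin n) (AdeleRing (𝓞 K) K),
        invQuot (AdelicGroupData.gl n K) Φ (y * k) = invQuot (AdelicGroupData.gl n K) Φ y) →
      ∀ {x : Fin n → ℂ}, (Finset.univ : Finset (Fin n)).val.map x = α v →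
      IsFundamentalDomain ↥(rationalUnipotent n K) 𝓕 ν → IsCompact (closure 𝓕) → IsGlobalAddChar K ψ →
      ∀ {T : GL (Fin n) (AdeleRing (𝓞 K) K)} {d : Fin n → (v.adicCompletion K)ˣ} {a : (v.adicCompletion K)ˣ},
      localComponent v T = diagonalGL (Fin n) (v.adicCompletion K) d →
      (∀ i j : Fin n, (i : ℕ) + 1 = j → (d i : v.adicCompletion K) * ((d j)⁻¹ : (v.adicCompletion K)ˣ) = a) →
      (∀ c ∈ 𝒪[v.adicCompletion K], ψ.adicComponent v (a * c) = 1) →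
      (∀ ϖ : v.adicCompletion K, Valued.v ϖ = WithZero.exp (-1 : ℤ) →
        ∃ c ∈ 𝒪[v.adicCompletion K], ψ.adicComponent v (a * (ϖ⁻¹ * c)) ≠ 1) →
      ∃ ϖ : (v.adicCompletion K)ˣ, IsTorusUnramifiedAt n K
        (fun g => whittakerCoeff ν 𝓕 ψ (invQuot (AdelicGroupData.gl n K) Φ) (T * g)) v ϖ x := by
  intro n K _ _ μ _ _ _ _ ν _ _ _ 𝓕 ψ P S α hα 𝔫₀ h𝔫₀ v hvS hv Φ hΦc sv hae hΦU x hx h𝓕 h𝓕c hψ T d a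
    hT hd hψa hψa'
  exact exists_isTorusUnramifiedAt_whittakerCoeff_of_ae_eq_translate P hα h𝔫₀ hvS hv hΦc sv hae hΦU hx
    h𝓕 h𝓕c hψ hT hd hψa hψa'

end Summit.Langlands.Langlands.Theorems.HonestTranslateUnramified
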